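import Summits.Ventures.HSemireg.UntwistCocycleTwistDualHomNaturality
import Summits.Ventures.HSemireg.UntwistCocycleTwistIota
import Mathlib.Topology.Sheaves.LocallySurjective
import HarnessLib

/-!
# `λ_G : (E ⊗ G)⟨c⟩ ⟶ E⟨c⟩ ⊗ G` is natural in `E`

Sequel to `UntwistCocycleTwistDualHom{,Naturality}.lean` (gs-g4 g19: `λ_G = dualHomTwist c E G`, natural in the
coefficients `G`).  Here: naturality in the MODULE `E` — for `g : E ⟶ E'`,

  `(g ⊗ G)⟨c⟩ ≫ λ^{E'}_G = λ^{E}_G ≫ (g⟨c⟩ ⊗ G)`   (`twistMap_twistMap_comp_dualHomTwist`),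

where `g ⊗ G = twistMap g G : 𝓗om(E^∨, G) → 𝓗om(E'^∨, G)` (pre-composition with `g^∨`) and `g⟨c⟩ = CocycleTwist.twistMap c g`.
Ingredient: the local trivialisations are natural, `g| ≫ t^{E'}_y = t^{E}_y ≫ g⟨c⟩|` (`over_map_comp_toTwistOver`).
This is what makes `λ` a morphism of COMPLEXES `(K ⊗ Ωʲ)⟨c⟩• ⟶ K⟨c⟩• ⊗ Ωʲ` for a cochain complex `K` (brick C3 of
general-structure/COMPLEX-LEIBNIZ-PLAN-gs-g4.md).

HONEST FRAMING (cell pub-hsemireg, seat gs-g4): module-level sheaf algebra on real carriers; NOT a door, NOT a named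
fact; nothing here says HC, HC_CM or HC_AV is proved.

## References
* R. Hartshorne, *Algebraic Geometry*, GTM 52 (1977), II Ex. 5.1 (b). [Hartshorne1977]
-/

noncomputable section

set_option backward.isDefEq.respectTransparency false

open CategoryTheory AlgebraicGeometry Opposite TopologicalSpace

namespace Summit.Ventures.HSemireg

namespace CocycleTwist

open Literature.AlgebraicGeometry.Modules Literature.AlgebraicGeometry.Motives
  Summit.HodgeConjecture.HodgeConjecture.Theorems.PadicPridhamSemiregularity

universe u

variable {S : Type u} [CommRing S] {X : Over (Spec (CommRingCat.of S))} (c : UnitCocycle X.left)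
  {E E' : X.left.Modules} (G : X.left.Modules)

/-- **The local trivialisations `t_y : F| ≅ F⟨c⟩|` are natural in `F`**: `g| ≫ t^{E'}_y = t^{E}_y ≫ g⟨c⟩|`.
[folklore] -/
theorem over_map_comp_toTwistOver (g : E ⟶ E') (y : X.left) (W : X.left.Opens) (hy : W ≤ c.U y) :
    (SheafOfModules.overFunctor _ W).map g ≫ toTwistOver c E' y W hy =
      toTwistOver c E y W hy ≫ (SheafOfModules.overFunctor _ W).map (twistMap c g) := by
  refine hom_ext_of_appLE fun V k e => ?_
  rw [appLE_comp, appLE_comp, appLE_over_map, appLE_toTwistOver, appLE_toTwistOver, appLE_over_map]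
  exact (twist_ext c E' fun w => by
    rw [comp_twistMap_app, comp_trivSection, comp_trivSection, Scheme.Modules.Hom.app_smul, app_map_apply]).symm

/-- **`λ` is natural in `E`**: `(g ⊗ G)⟨c⟩ ≫ λ^{E'}_G = λ^{E}_G ≫ (g⟨c⟩ ⊗ G)` for `g : E ⟶ E'`.
[cite: Hartshorne1977, II Ex. 5.1 (b)] -/
theorem twistMap_twistMap_comp_dualHomTwist (g : E ⟶ E') :
    twistMap c (Summit.HodgeConjecture.HodgeConjecture.Theorems.PadicPridhamSemiregularity.twistMap g G) ≫
        dualHomTwist c E' G =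
      dualHomTwist c E G ≫
        Summit.HodgeConjecture.HodgeConjecture.Theorems.PadicPridhamSemiregularity.twistMap (twistMap c g) G := by
  refine twist_hom_ext c _ fun x V hV (φ : Γ(sheafHom (dual E) G, V)) => ?_
  change (dualHomTwist c E' G).app V ((twistMap c _).app V (trivSection c _ x hV φ)) =
    (Summit.HodgeConjecture.HodgeConjecture.Theorems.PadicPridhamSemiregularity.twistMap (twistMap c g) G).app V
      ((dualHomTwist c E G).app V (trivSection c _ x hV φ))
  rw [twistMap_app_trivSection, sheafHomPrecomp_app_apply, sheafHomPrecomp_app_apply]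
  refine hom_ext_of_appLE_le c fun y W k hy (μ : (twist c E').over W ⟶ (unitModule X.left).over W) => ?_
  rw [appLE_dualHomTwist_trivSection c E' x y hV k hy, appLE_comp, appLE_over_map, sheafHomPrecomp_app_apply,
    appLE_comp, appLE_over_map, sheafHomPrecomp_app_apply, appLE_dualHomTwist_trivSection c E x y hV k hy,
    ← Category.assoc, over_map_comp_toTwistOver, Category.assoc]

/-! ### `λ_G` is an isomorphism -/

/-- `λ_G` is injective on sections: a glue family `(φ_x)` with `λ_G(φ) = 0` has `φ_y = 0` for every `y`
(test against `μ = t_y⁻¹ ≫ ν`). [folklore] -/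
theorem dualHomTwist_app_injective (E G : X.left.Modules) (V : X.left.Opens) :
    Function.Injective ((dualHomTwist c E G).app V) := by
  intro s s' h
  rw [← sub_eq_zero] at h ⊢
  rw [← map_sub] at h
  generalize s - s' = t at h ⊢
  refine twist_ext c _ fun y => ?_
  rw [comp_zero]
  refine hom_ext_of_appLE fun W k (ν : Γ(dual E, W)) => ?_
  rw [appLE_zero]
  have hy : W ≤ c.U y := k.le.trans inf_le_right
  have hk := appLE_dualHomTwist c E G y t (k ≫ homOfLE inf_le_left) hy
    (ofTwistOver c E y W hy ≫ (ν : E.over W ⟶ (unitModule X.left).over W))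
  rw [h] at hk
  erw [appLE_zero] at hk
  rw [← Category.assoc, toTwistOver_comp_ofTwistOver, Category.id_comp] at hk
  rw [appLE_congr_hom _ k (homOfLE (le_inf (k.le.trans inf_le_left) hy)), ← hk]

/-- `λ_G` is a monomorphism. [folklore] -/
theorem mono_dualHomTwist (E G : X.left.Modules) : Mono (dualHomTwist c E G) := by
  haveI : ∀ U, Mono ((dualHomTwist c E G).mapPresheaf.app U) := fun U =>
    ConcreteCategory.mono_of_injective _ (dualHomTwist_app_injective c E G U.unop)
  haveI : Mono (dualHomTwist c E G).mapPresheaf := NatTrans.mono_of_mono_app _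
  exact (Scheme.Modules.toPresheaf X.left).mono_of_mono_map this

/-- `λ_G` is locally surjective on sections: over `W ⊆ U_v`, `ψ = λ_G((t_v⁻¹)^* ψ ⊗ t_v)`. [folklore] -/
theorem dualHomTwist_app_trivSection_precompOver (E G : X.left.Modules) (v : X.left) {W : X.left.Opens} (hW : W ≤ c.U v)
    (ψ : (dual (twist c E)).over W ⟶ G.over W) :
    ((dualHomTwist c E G).app W (trivSection c (sheafHom (dual E) G) v hW
        (precompOver (unitModule X.left) (ofTwistOver c E v W hW) ≫ ψ)) :
      (dual (twist c E)).over W ⟶ G.over W) = ψ := by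
  refine hom_ext_of_appLE fun W' l (μ : (twist c E).over W' ⟶ (unitModule X.left).over W') => ?_
  rw [appLE_dualHomTwist_trivSection c E v v hW l (l.le.trans hW), c.g_self, one_smul, appLE_comp,
    appLE_precompOver, ← restrictHom_toTwistOver c E v W hW l, ← Category.assoc, ← restrictHom_comp,
    show ofTwistOver c E v W hW ≫ toTwistOver c E v W hW = 𝟙 _ from (twistTrivOver c E v W hW).inv_hom_id,
    restrictHom_id, Category.id_comp]

/-- `λ_G` is an epimorphism (locally surjective on sections). [folklore] -/
theorem epi_dualHomTwist (E G : X.left.Modules) : Epi (dualHomTwist c E G) := by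
  have hls : TopCat.Presheaf.IsLocallySurjective (dualHomTwist c E G).mapPresheaf := by
    rw [TopCat.Presheaf.isLocallySurjective_iff]
    intro V ψ v hv
    refine ⟨V ⊓ c.U v, inf_le_left, ⟨trivSection c (sheafHom (dual E) G) v inf_le_right
      (precompOver (unitModule X.left) (ofTwistOver c E v _ inf_le_right) ≫
        restrictHom (homOfLE inf_le_left) (ψ : (dual (twist c E)).over V ⟶ G.over V)), ?_⟩, ⟨hv, c.mem v⟩⟩
    exact dualHomTwist_app_trivSection_precompOver c E G v inf_le_right _
  have h1 : Epi ((SheafOfModules.toSheaf X.left.ringCatSheaf).map (dualHomTwist c E G)) :=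
    (TopCat.Sheaf.isLocallySurjective_iff_epi _).mp hls
  have h2 := (SheafOfModules.toSheaf X.left.ringCatSheaf).epi_of_epi_map h1
  exact ⟨fun _ _ hh => (@cancel_epi _ _ _ _ _ _ h2 _ _).mp hh⟩

/-- **`λ_G` is an isomorphism.** [cite: Hartshorne1977, II Ex. 5.1 (b)] -/
theorem isIso_dualHomTwist (E G : X.left.Modules) : IsIso (dualHomTwist c E G) := by
  haveI := mono_dualHomTwist c E G
  haveI := epi_dualHomTwist c E G
  exact isIso_of_mono_of_epi _

end CocycleTwist

end Summit.Ventures.HSemireg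

end
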